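import Summits.ABC.IUTFork.Conditional.AbcOfSGenuineMOrbit
import HarnessLib

/-!
# Branch C certificate v8, APEX (G1-Θ unit P7, second step): `abc_of_SH_v8M` — `ABC` from S_H + q-pin + provenance + the per-packet
# ORBIT-HULL bound at the summand-route M-LEVEL GENUINE REAL SETTING of every datum, and the hull-regime cone `hreg`

C scoreboard, v8 companion: per datum S_H 1 · PIN 1 · PROV 1 · ORBIT 1 (`hA`) · BRIDGE 0 · READ 0 · SIDE 0 · FACT 0 = 4 (explicit), plus the
(P,l)-level CONE binder `hreg` = 5; EFFECTIVE: tool line on STATUS. The per-datum theorem and every discharge are in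
`Conditional/AbcOfSGenuineMOrbit.lean` (`GenuineMOrbit.cor312Of_of_SH`); this file is the family-level assembly through abc-iut-c312-8's
`ThetaPartII.ABC_of_cor312_of_hullRegime` (p428563), exactly as v7 `abc_of_SH_v7M` (p439027: 6) and v5 `abc_of_SH_v5K` (p434856, §K line of
record: 9). FIRST CERTIFICATE OF THE CAMPAIGN WITHOUT THE Θ-SIDE READ BINDER `hΘ` (present since v0 p427180): it is DISCHARGED MODULO the
per-packet orbit-hull bound `hA` (abc-iut-w5-d166 p438889 ∘ abc-iut-w5-d033 p436273), and `BridgeHyps` is a theorem (abc-iut-s2-p8 p438078).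
The two named binders [PROV] / [ORBIT] are the typed targets of G1-Θ P5-numbers (abc-iut-w5-d244) / (U1)-HULL instA·instB (abc-iut-s2-p8,
abc-iut-s2-p7); when they land the companion `Shrink` instantiates them BY NAME and the certificate reads S_H 1 · PIN 1 + CONE 1.

PROOF-ONLY file (no `def`, no new `Prop`) by the INTAKE seat abc-iut-C-cert-3. HONEST FRAMING: this campaign LOCATES / CONDITIONALLY
VERIFIES. Nothing here asserts that abc is proved or refuted, or that [IUTchIII] Cor. 3.12 / Thm. 3.11 holds or fails, or takes a side on
any author (Mochizuki / Scholze–Stix / Joshi / Dupuy–Hilado); «`ABC` follows from S_H + the listed hypotheses AS TYPED, at these data»,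
nothing more; S_H is an assumption label; typed ≠ proved; instantiated ≠ endorsed. [claim: Mochizuki2012, status: disputed]
[cite: Mochizuki2012, IUTchI Def. 3.1 (e) p. 62; IUTchIII Cor. 3.12 p. 173–174, Step (xi-d) p. 183; IUTchIV Thm. 1.10 Steps (v)–(vi) p. 27–30, p. 23]
-/

noncomputable section

open Set Function NumberField IsDedekindDomain

namespace Summit.ABC.IUTFork.Conditional

open Thm311 Thm311.Real Cor312 Cor312Vol Cor312Prov Literature.IUT.LogThetaLattice Literature.IUT.LogVolume
  Literature.IUT.HodgeTheaters Literature.IUT.LogVolume.ThetaData Literature.NumberTheory.NumberFields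

/-! ## The apex: `ABC` from S_H + q-pin + provenance + orbit-hull bound per datum, and the hull-regime cone `hreg` -/

section Family

open Literature.NumberTheory.DiophantineGeometry.GenEll Summit.ABC.ABC.Theorems

/-- **`abc_of_SH_v8M` (branch C certificate v8, G1-Θ unit P7 second step: HULL-LEVEL line AT THE SUMMAND-ROUTE M-LEVEL GENUINE REAL SETTING
of each datum — carriers `K_{v̲}`, `v̲ ∈ V̲`, pilot regions read off the datum's OWN ideles; per datum explicit S_H 1 · PIN 1 · PROV 1 · ORBIT 1 ·
BRIDGE 0 · READ 0 · SIDE 0 · FACT 0, plus the (P,l)-level CONE binder `hreg`).** `ABC` from, per `λ`-line point `P`, prime `l` and genuine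
Θ-volume datum `T`: DATA = the context binders of abc-iut-s2-p8's `settingPrVolSharpM T.D …` (logs FIXED: analytic; free columns), PR-1's `ρ`,
`qK` — NO pilot-data / provenance-data / field / idele binder; HYPOTHESES = [S_H] `hSH` · [PIN] `hQPin` · [PROV] `hprov` (`IsSettingOf T.D P`:
the q-number) · [CONE] `hreg` (c312-8 p428563's, verbatim) · [ORBIT] `hA` (the per-packet orbit-hull bound; `BridgeHyps` and the Θ-side
identification are THEOREMS inside, abc-iut-s2-p8 p438078 / abc-iut-w5-d166 p438889). Proof: the per-datum theorem at `T.D`, `T.I`,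
`T.isVolumeInputOf` gives `Cor22.Cor312AtDatum P l`; then `ThetaPartII.ABC_of_cor312_of_hullRegime`. «`ABC` follows from S_H + these
hypotheses as typed, at these data» — no side taken on [IUTchIII] Cor. 3.12; typed ≠ proved; instantiated ≠ endorsed.
[claim: Mochizuki2012, status: disputed] -/
theorem abc_of_SH_v8M
    -- DATA, per datum: the context binders of the summand-route M-level sharp setting (logs FIXED: analytic), the column data, ρ, qK
    (M : ∀ (P : NFPoint) (l : ℕ) (T : Cor22.ThetaVolumeDatumAt P l), Type) [∀ P l T, Field (M P l T)] [∀ P l T, NumberField (M P l T)]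
    (archPk : ∀ (P : NFPoint) (l : ℕ) (T : Cor22.ThetaVolumeDatumAt P l), letI := T.instFieldF; letI := T.instNumberFieldF; letI := T.instAlgebraF; letI := T.instFieldK;
        letI := T.instNumberFieldK; letI := T.instAlgebraK; letI := T.instFieldFbar; letI := T.instAlgebraFbar;
        letI := T.instAlgebraKFbar; letI := T.instIsElliptic;
      ∀ (j : (thetaIndexOfInitial T.D).Label) (vQ : (thetaIndexOfInitial T.D).VQ), Set ((logShellsOfInitialDH T.D (analyticLogvVal T.K)).Packet j vQ))
    (archSub : ∀ (P : NFPoint) (l : ℕ) (T : Cor22.ThetaVolumeDatumAt P l), letI := T.instFieldF; letI := T.instNumberFieldF; letI := T.instAlgebraF; letI := T.instFieldK;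
        letI := T.instNumberFieldK; letI := T.instAlgebraK; letI := T.instFieldFbar; letI := T.instAlgebraFbar;
        letI := T.instAlgebraKFbar; letI := T.instIsElliptic;
      ∀ (j : (thetaIndexOfInitial T.D).Label) (v : (thetaIndexOfInitial T.D).V), Set ((logShellsOfInitialDH T.D (analyticLogvVal T.K)).Packet j ((thetaIndexOfInitial T.D).over v)))
    (Ψ : ∀ (P : NFPoint) (l : ℕ) (T : Cor22.ThetaVolumeDatumAt P l), letI := T.instFieldF; letI := T.instNumberFieldF; letI := T.instAlgebraF; letI := T.instFieldK;
        letI := T.instNumberFieldK; letI := T.instAlgebraK; letI := T.instFieldFbar; letI := T.instAlgebraFbar;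
        letI := T.instAlgebraKFbar; letI := T.instIsElliptic;
      ℤ → ∀ v : (thetaIndexOfInitial T.D).V, v ∈ (thetaIndexOfInitial T.D).Vbad → Set ((logShellsOfInitialDH T.D (analyticLogvVal T.K)).StarPacket v))
    (act : ∀ (P : NFPoint) (l : ℕ) (T : Cor22.ThetaVolumeDatumAt P l), letI := T.instFieldF; letI := T.instNumberFieldF; letI := T.instAlgebraF; letI := T.instFieldK;
        letI := T.instNumberFieldK; letI := T.instAlgebraK; letI := T.instFieldFbar; letI := T.instAlgebraFbar;
        letI := T.instAlgebraKFbar; letI := T.instIsElliptic;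
      ℤ → ∀ v : (thetaIndexOfInitial T.D).V, v ∈ (thetaIndexOfInitial T.D).Vbad → (logShellsOfInitialDH T.D (analyticLogvVal T.K)).StarPacket v → Module.End ℚ ((logShellsOfInitialDH T.D (analyticLogvVal T.K)).StarPacket v))
    (Mmod : ∀ (P : NFPoint) (l : ℕ) (T : Cor22.ThetaVolumeDatumAt P l), letI := T.instFieldF; letI := T.instNumberFieldF; letI := T.instAlgebraF; letI := T.instFieldK;
        letI := T.instNumberFieldK; letI := T.instAlgebraK; letI := T.instFieldFbar; letI := T.instAlgebraFbar;
        letI := T.instAlgebraKFbar; letI := T.instIsElliptic;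
      ℤ → ∀ j : (thetaIndexOfInitial T.D).LabelStar, Set ((logShellsOfInitialDH T.D (analyticLogvVal T.K)).GlobalPacket j.1))
    (region : ∀ (P : NFPoint) (l : ℕ) (T : Cor22.ThetaVolumeDatumAt P l), letI := T.instFieldF; letI := T.instNumberFieldF; letI := T.instAlgebraF; letI := T.instFieldK;
        letI := T.instNumberFieldK; letI := T.instAlgebraK; letI := T.instFieldFbar; letI := T.instAlgebraFbar;
        letI := T.instAlgebraKFbar; letI := T.instIsElliptic;
      ℤ → ∀ j : (thetaIndexOfInitial T.D).LabelStar, FinDivisor (M P l T) → ∀ vQ : (thetaIndexOfInitial T.D).VQ, Set ((logShellsOfInitialDH T.D (analyticLogvVal T.K)).Packet j.1 vQ))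
    (frobAdm : ∀ (P : NFPoint) (l : ℕ) (T : Cor22.ThetaVolumeDatumAt P l), letI := T.instFieldF; letI := T.instNumberFieldF; letI := T.instAlgebraF; letI := T.instFieldK;
        letI := T.instNumberFieldK; letI := T.instAlgebraK; letI := T.instFieldFbar; letI := T.instAlgebraFbar;
        letI := T.instAlgebraKFbar; letI := T.instIsElliptic;
      ℤ → ℤ → ∀ (j : (thetaIndexOfInitial T.D).Label) (vQ : (thetaIndexOfInitial T.D).VQ), Set ((logShellsOfInitialDH T.D (analyticLogvVal T.K)).Packet j vQ) → Prop)
    (frobLogvol : ∀ (P : NFPoint) (l : ℕ) (T : Cor22.ThetaVolumeDatumAt P l), letI := T.instFieldF; letI := T.instNumberFieldF; letI := T.instAlgebraF; letI := T.instFieldK;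
        letI := T.instNumberFieldK; letI := T.instAlgebraK; letI := T.instFieldFbar; letI := T.instAlgebraFbar;
        letI := T.instAlgebraKFbar; letI := T.instIsElliptic;
      ℤ → ℤ → ∀ (j : (thetaIndexOfInitial T.D).Label) (vQ : (thetaIndexOfInitial T.D).VQ), Set ((logShellsOfInitialDH T.D (analyticLogvVal T.K)).Packet j vQ) → ℝ)
    (frobΨ : ∀ (P : NFPoint) (l : ℕ) (T : Cor22.ThetaVolumeDatumAt P l), letI := T.instFieldF; letI := T.instNumberFieldF; letI := T.instAlgebraF; letI := T.instFieldK;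
        letI := T.instNumberFieldK; letI := T.instAlgebraK; letI := T.instFieldFbar; letI := T.instAlgebraFbar;
        letI := T.instAlgebraKFbar; letI := T.instIsElliptic;
      ℤ → ℤ → ∀ v : (thetaIndexOfInitial T.D).V, v ∈ (thetaIndexOfInitial T.D).Vbad → Set ((logShellsOfInitialDH T.D (analyticLogvVal T.K)).StarPacket v))
    (frobMmod : ∀ (P : NFPoint) (l : ℕ) (T : Cor22.ThetaVolumeDatumAt P l), letI := T.instFieldF; letI := T.instNumberFieldF; letI := T.instAlgebraF; letI := T.instFieldK;
        letI := T.instNumberFieldK; letI := T.instAlgebraK; letI := T.instFieldFbar; letI := T.instAlgebraFbar;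
        letI := T.instAlgebraKFbar; letI := T.instIsElliptic;
      ℤ → ℤ → ∀ j : (thetaIndexOfInitial T.D).LabelStar, Set ((logShellsOfInitialDH T.D (analyticLogvVal T.K)).GlobalPacket j.1))
    (unitImage : ∀ (P : NFPoint) (l : ℕ) (T : Cor22.ThetaVolumeDatumAt P l), letI := T.instFieldF; letI := T.instNumberFieldF; letI := T.instAlgebraF; letI := T.instFieldK;
        letI := T.instNumberFieldK; letI := T.instAlgebraK; letI := T.instFieldFbar; letI := T.instAlgebraFbar;
        letI := T.instAlgebraKFbar; letI := T.instIsElliptic;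
      ℤ → ℤ → ℕ → ∀ (j : (thetaIndexOfInitial T.D).Label) (vQ : (thetaIndexOfInitial T.D).VQ), Set ((logShellsOfInitialDH T.D (analyticLogvVal T.K)).Packet j vQ))
    (ballImage : ∀ (P : NFPoint) (l : ℕ) (T : Cor22.ThetaVolumeDatumAt P l), letI := T.instFieldF; letI := T.instNumberFieldF; letI := T.instAlgebraF; letI := T.instFieldK;
        letI := T.instNumberFieldK; letI := T.instAlgebraK; letI := T.instFieldFbar; letI := T.instAlgebraFbar;
        letI := T.instAlgebraKFbar; letI := T.instIsElliptic;
      ℤ → ℤ → ∀ (j : (thetaIndexOfInitial T.D).Label) (vQ : (thetaIndexOfInitial T.D).VQ), Set ((logShellsOfInitialDH T.D (analyticLogvVal T.K)).Packet j vQ))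
    (thetaDiv : ∀ (P : NFPoint) (l : ℕ) (T : Cor22.ThetaVolumeDatumAt P l), letI := T.instFieldF; letI := T.instNumberFieldF; letI := T.instAlgebraF; letI := T.instFieldK;
        letI := T.instNumberFieldK; letI := T.instAlgebraK; letI := T.instFieldFbar; letI := T.instAlgebraFbar;
        letI := T.instAlgebraKFbar; letI := T.instIsElliptic;
      ℤ → ℤ → LgpDivisor (M P l T) (thetaIndexOfInitial T.D).lstar)
    (n : ∀ (P : NFPoint) (l : ℕ) (T : Cor22.ThetaVolumeDatumAt P l), ℤ)
    {HT : ∀ (P : NFPoint) (l : ℕ) (T : Cor22.ThetaVolumeDatumAt P l), Type} {LogLink : ∀ (P : NFPoint) (l : ℕ) (T : Cor22.ThetaVolumeDatumAt P l), HT P l T → HT P l T → Type}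
    {IsFull : ∀ (P : NFPoint) (l : ℕ) (T : Cor22.ThetaVolumeDatumAt P l), ∀ {s t : HT P l T}, LogLink P l T s t → Prop}
    (lat : ∀ (P : NFPoint) (l : ℕ) (T : Cor22.ThetaVolumeDatumAt P l), LGPGaussianLogThetaLattice (LogLink P l T) (IsFull P l T))
    {Frd : ∀ (P : NFPoint) (l : ℕ) (T : Cor22.ThetaVolumeDatumAt P l), Type} {IsoF : ∀ (P : NFPoint) (l : ℕ) (T : Cor22.ThetaVolumeDatumAt P l), Frd P l T → Frd P l T → Type} {Ob : ∀ (P : NFPoint) (l : ℕ) (T : Cor22.ThetaVolumeDatumAt P l), Frd P l T → Type}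
    {realify : ∀ (P : NFPoint) (l : ℕ) (T : Cor22.ThetaVolumeDatumAt P l), Frd P l T → Frd P l T} {Strip : ∀ (P : NFPoint) (l : ℕ) (T : Cor22.ThetaVolumeDatumAt P l), Type} {IsoS : ∀ (P : NFPoint) (l : ℕ) (T : Cor22.ThetaVolumeDatumAt P l), Strip P l T → Strip P l T → Type}
    {Mv : ∀ (P : NFPoint) (l : ℕ) (T : Cor22.ThetaVolumeDatumAt P l), letI := T.instFieldF; letI := T.instNumberFieldF; letI := T.instAlgebraF; letI := T.instFieldK;
        letI := T.instNumberFieldK; letI := T.instAlgebraK; letI := T.instFieldFbar; letI := T.instAlgebraFbar;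
        letI := T.instAlgebraKFbar; letI := T.instIsElliptic;
      ∀ v : (thetaIndexOfInitial T.D).V, v ∈ (thetaIndexOfInitial T.D).Vbad → Type}
    [∀ P l T v h, Monoid (Mv P l T v h)]
    (sig : ∀ (P : NFPoint) (l : ℕ) (T : Cor22.ThetaVolumeDatumAt P l), letI := T.instFieldF; letI := T.instNumberFieldF; letI := T.instAlgebraF; letI := T.instFieldK;
        letI := T.instNumberFieldK; letI := T.instAlgebraK; letI := T.instFieldFbar; letI := T.instAlgebraFbar;
        letI := T.instAlgebraKFbar; letI := T.instIsElliptic;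
      GlobalLGPFrobenioidSignature (thetaIndexOfInitial T.D).lstar (thetaIndexOfInitial T.D).V (· ∈ (thetaIndexOfInitial T.D).Vbad) (Frd P l T) (IsoF P l T) (Ob P l T) (realify P l T)
        (Strip P l T) (IsoS P l T) (Mv P l T))
    (split : ∀ (P : NFPoint) (l : ℕ) (T : Cor22.ThetaVolumeDatumAt P l), SplittingMonoids (Mv P l T))
    {ObΔ : ∀ (P : NFPoint) (l : ℕ) (T : Cor22.ThetaVolumeDatumAt P l), Type}
    {N : ∀ (P : NFPoint) (l : ℕ) (T : Cor22.ThetaVolumeDatumAt P l), letI := T.instFieldF; letI := T.instNumberFieldF; letI := T.instAlgebraF; letI := T.instFieldK;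
        letI := T.instNumberFieldK; letI := T.instAlgebraK; letI := T.instFieldFbar; letI := T.instAlgebraFbar;
        letI := T.instAlgebraKFbar; letI := T.instIsElliptic;
      ∀ v : (thetaIndexOfInitial T.D).V, v ∈ (thetaIndexOfInitial T.D).Vbad → Type}
    [∀ P l T v h, Monoid (N P l T v h)] (qData : ∀ (P : NFPoint) (l : ℕ) (T : Cor22.ThetaVolumeDatumAt P l), QPilotData (ObΔ P l T) (N P l T))
    (ρ : ∀ (P : NFPoint) (l : ℕ) (T : Cor22.ThetaVolumeDatumAt P l), letI := T.instFieldF; letI := T.instNumberFieldF; letI := T.instAlgebraF; letI := T.instFieldK;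
        letI := T.instNumberFieldK; letI := T.instAlgebraK; letI := T.instFieldFbar; letI := T.instAlgebraFbar;
        letI := T.instAlgebraKFbar; letI := T.instIsElliptic;
      (∀ v : (thetaIndexOfInitial T.D).V, v ∈ (thetaIndexOfInitial T.D).Vbad → Set ((logShellsOfInitialDH T.D (analyticLogvVal T.K)).StarPacket v)) →
        ∀ (j : (thetaIndexOfInitial T.D).Label) (vQ : (thetaIndexOfInitial T.D).VQ), Set ((logShellsOfInitialDH T.D (analyticLogvVal T.K)).Packet j vQ))
    (qK : ∀ (P : NFPoint) (l : ℕ) (T : Cor22.ThetaVolumeDatumAt P l), letI := T.instFieldF; letI := T.instNumberFieldF; letI := T.instAlgebraF; letI := T.instFieldK;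
        letI := T.instNumberFieldK; letI := T.instAlgebraK; letI := T.instFieldFbar; letI := T.instAlgebraFbar;
        letI := T.instAlgebraKFbar; letI := T.instIsElliptic;
      ∀ v : (thetaIndexOfInitial T.D).V, v ∈ (thetaIndexOfInitial T.D).Vbad → Set ((logShellsOfInitialDH T.D (analyticLogvVal T.K)).StarPacket v))
    -- [S_H] the HULL-LEVEL form of the printed clause, at every datum, AT THESE DATA (summand-route M-setting of the datum's own ideles)
    (hSH : ∀ (P : NFPoint) (l : ℕ) (T : Cor22.ThetaVolumeDatumAt P l), letI := T.instFieldF; letI := T.instNumberFieldF; letI := T.instAlgebraF; letI := T.instFieldK;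
        letI := T.instNumberFieldK; letI := T.instAlgebraK; letI := T.instFieldFbar; letI := T.instAlgebraFbar;
        letI := T.instAlgebraKFbar; letI := T.instIsElliptic;
      Cor312Vol.PilotKummerCompatHull
        (LatticeSituation.ofShells (logShellsOfInitialDH T.D (analyticLogvVal T.K)) (M P l T) (archPk P l T) (archSub P l T)
          (summandPiecesPrM T.D (logvAnalyticVal_analyticLogvVal (K := T.K))).Adm
          (summandPiecesPrM T.D (logvAnalyticVal_analyticLogvVal (K := T.K))).logvol (Ψ P l T) (act P l T) (Mmod P l T)
          (region P l T) (frobAdm P l T) (frobLogvol P l T) (frobΨ P l T) (frobMmod P l T) (unitImage P l T) (ballImage P l T)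
          (thetaDiv P l T))
        (settingPrVolSharpM T.D (logvAnalyticVal_analyticLogvVal (K := T.K)) (tOfIdeleData T.D (ideleDataOf T.D T.isVolumeInputOf))
          (fun u x => tqM T.D (ratChar u) u (natCast_ratChar_mem u) (ideleDataOf T.D T.isVolumeInputOf) x)
          (M P l T) (archPk P l T) (archSub P l T) (Ψ P l T) (act P l T)
          (Mmod P l T) (region P l T) (n P l T) (lat P l T) (sig P l T) (split P l T) (qData P l T)
          (fun u x => tqM_ne_zero T.D (ratChar u) u (natCast_ratChar_mem u) (ideleDataOf T.D T.isVolumeInputOf) x)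
          (GenuineM.finite_ratPlaces_under_S T.D).toFinset
          (fun u x hu => norm_tqM_eq_one_of_not_mem T.D (ratChar u) u (natCast_ratChar_mem u) (ideleDataOf T.D T.isVolumeInputOf) x
            fun hx => hu ((Set.Finite.mem_toFinset _).mpr ⟨x, hx⟩))) (ρ P l T) (qK P l T))
    -- [PIN] the q-pin (pq′) ONLY
    (hQPin : ∀ (P : NFPoint) (l : ℕ) (T : Cor22.ThetaVolumeDatumAt P l), letI := T.instFieldF; letI := T.instNumberFieldF; letI := T.instAlgebraF; letI := T.instFieldK;
        letI := T.instNumberFieldK; letI := T.instAlgebraK; letI := T.instFieldFbar; letI := T.instAlgebraFbar;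
        letI := T.instAlgebraKFbar; letI := T.instIsElliptic;
      Cor312Vol.QPinned
        (LatticeSituation.ofShells (logShellsOfInitialDH T.D (analyticLogvVal T.K)) (M P l T) (archPk P l T) (archSub P l T)
          (summandPiecesPrM T.D (logvAnalyticVal_analyticLogvVal (K := T.K))).Adm
          (summandPiecesPrM T.D (logvAnalyticVal_analyticLogvVal (K := T.K))).logvol (Ψ P l T) (act P l T) (Mmod P l T)
          (region P l T) (frobAdm P l T) (frobLogvol P l T) (frobΨ P l T) (frobMmod P l T) (unitImage P l T) (ballImage P l T)
          (thetaDiv P l T))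
        (settingPrVolSharpM T.D (logvAnalyticVal_analyticLogvVal (K := T.K)) (tOfIdeleData T.D (ideleDataOf T.D T.isVolumeInputOf))
          (fun u x => tqM T.D (ratChar u) u (natCast_ratChar_mem u) (ideleDataOf T.D T.isVolumeInputOf) x)
          (M P l T) (archPk P l T) (archSub P l T) (Ψ P l T) (act P l T)
          (Mmod P l T) (region P l T) (n P l T) (lat P l T) (sig P l T) (split P l T) (qData P l T)
          (fun u x => tqM_ne_zero T.D (ratChar u) u (natCast_ratChar_mem u) (ideleDataOf T.D T.isVolumeInputOf) x)
          (GenuineM.finite_ratPlaces_under_S T.D).toFinset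
          (fun u x hu => norm_tqM_eq_one_of_not_mem T.D (ratChar u) u (natCast_ratChar_mem u) (ideleDataOf T.D T.isVolumeInputOf) x
            fun hx => hu ((Set.Finite.mem_toFinset _).mpr ⟨x, hx⟩))) (ρ P l T) (qK P l T))
    -- [PROV] abc-iut-c312-8's provenance link (the q-number `P.negLogQ = −absLogq T.D`; G1-Θ P5-numbers' target AS TYPED via `isSettingOf_ofInitial`)
    (hprov : ∀ (P : NFPoint) (l : ℕ) (T : Cor22.ThetaVolumeDatumAt P l), letI := T.instFieldF; letI := T.instNumberFieldF; letI := T.instAlgebraF; letI := T.instFieldK;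
        letI := T.instNumberFieldK; letI := T.instAlgebraK; letI := T.instFieldFbar; letI := T.instAlgebraFbar;
        letI := T.instAlgebraKFbar; letI := T.instIsElliptic;
      Cor312Prov.IsSettingOf T.D
        (settingPrVolSharpM T.D (logvAnalyticVal_analyticLogvVal (K := T.K)) (tOfIdeleData T.D (ideleDataOf T.D T.isVolumeInputOf))
          (fun u x => tqM T.D (ratChar u) u (natCast_ratChar_mem u) (ideleDataOf T.D T.isVolumeInputOf) x)
          (M P l T) (archPk P l T) (archSub P l T) (Ψ P l T) (act P l T)
          (Mmod P l T) (region P l T) (n P l T) (lat P l T) (sig P l T) (split P l T) (qData P l T)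
          (fun u x => tqM_ne_zero T.D (ratChar u) u (natCast_ratChar_mem u) (ideleDataOf T.D T.isVolumeInputOf) x)
          (GenuineM.finite_ratPlaces_under_S T.D).toFinset
          (fun u x hu => norm_tqM_eq_one_of_not_mem T.D (ratChar u) u (natCast_ratChar_mem u) (ideleDataOf T.D T.isVolumeInputOf) x
            fun hx => hu ((Set.Finite.mem_toFinset _).mpr ⟨x, hx⟩))))
    -- [BRIDGE] none (theorem) · [READ] none (theorem modulo hA) · [FACT] none · [SIDE] none · [CONE] c312-8 p428563's `hreg`, verbatim
    (hreg : ∀ P : NFPoint, P ∈ UP → ∀ l : ℕ, l.Prime → 5 ≤ l →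
      Cor22.AdmitsCore P → Cor22.CondP2 P l → Cor22.CondP5 P l → Cor22.CondP6 P l →
      ∀ T : Cor22.ThetaVolumeDatumAt P l,
        (letI := T.instFieldF; letI := T.instNumberFieldF; letI := T.instAlgebraF; letI := T.instFieldK
         letI := T.instNumberFieldK; letI := T.instAlgebraK; letI := T.instFieldFbar; letI := T.instAlgebraFbar
         letI := T.instAlgebraKFbar; letI := T.instIsElliptic
         ¬ (∀ p ∈ T.I.supportPrimes, ∀ v w : placesOver (fieldOfModuli T.E) p,
            (Summit.ABC.IUTFork.DHData.ofInput T.I).logQloc p v = (Summit.ABC.IUTFork.DHData.ofInput T.I).logQloc p w)) →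
        T.HullEstimateOf
          (((l : ℝ) + 1) / 4 *
            ((1 + 12 * (Cor22.dmod P : ℝ) / l) * (P.logDiff + Cor22.logCondAvoid P {2, l})
              + 2 * Real.log l + 52
              + 20 / 3 * Real.log (((2 ^ 12 * 3 ^ 3 * 5 * Cor22.dmod P : ℕ) : ℝ) * (l : ℝ))
                * (Nat.primeCounting (2 ^ 12 * 3 ^ 3 * 5 * Cor22.dmod P * l) : ℝ))))
    -- [ORBIT] the per-packet (Ind1)(Ind2)-ORBIT-HULL bound of the local Θ-volume at every finite place (G1-Θ (U1)-HULL instA/instB target AS TYPED, p438889's `hA`)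
    (hA : ∀ (P : NFPoint) (l : ℕ) (T : Cor22.ThetaVolumeDatumAt P l), letI := T.instFieldF; letI := T.instNumberFieldF; letI := T.instAlgebraF; letI := T.instFieldK;
        letI := T.instNumberFieldK; letI := T.instAlgebraK; letI := T.instFieldFbar; letI := T.instAlgebraFbar;
        letI := T.instAlgebraKFbar; letI := T.instIsElliptic;
      ∀ (i : Fin (thetaIndexOfInitial T.D).lstar) (u : FinitePlace ℚ),
        (settingMSharp T.D (logvAnalyticVal_analyticLogvVal (K := T.K))
          (M P l T) (archPk P l T) (archSub P l T) (Ψ P l T) (act P l T)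
          (Mmod P l T) (region P l T) (n P l T) (lat P l T) (sig P l T) (split P l T) (qData P l T)
          (tOfIdeleData T.D (ideleDataOf T.D T.isVolumeInputOf))
          (fun u x => tqM T.D (ratChar u) u (natCast_ratChar_mem u) (ideleDataOf T.D T.isVolumeInputOf) x)
          (fun u x => tqM_ne_zero T.D (ratChar u) u (natCast_ratChar_mem u) (ideleDataOf T.D T.isVolumeInputOf) x)
          (GenuineM.finite_ratPlaces_under_S T.D).toFinset
          (fun u x hu => norm_tqM_eq_one_of_not_mem T.D (ratChar u) u (natCast_ratChar_mem u) (ideleDataOf T.D T.isVolumeInputOf) x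
            fun hx => hu ((Set.Finite.mem_toFinset _).mpr ⟨x, hx⟩))).thetaLocal (Setting.labelSucc i) (Val.non u) ≤
          ((orbitSumM T.D (ideleDataOf T.D T.isVolumeInputOf) i u : ℝ) : WithTop ℝ))
    : _root_.ABC := by
  -- Step 1–2: [IUTchIII] Cor 3.12 at EVERY genuine Θ-volume datum on the HULL-LEVEL line at the summand-route M-setting (per-datum file, under `T`'s bundled instances)
  have h312 : ∀ (P : NFPoint) (l : ℕ), Cor22.Cor312AtDatum P l := fun P l T => by
    letI := T.instFieldF; letI := T.instNumberFieldF; letI := T.instAlgebraF; letI := T.instFieldK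
    letI := T.instNumberFieldK; letI := T.instAlgebraK; letI := T.instFieldFbar; letI := T.instAlgebraFbar
    letI := T.instAlgebraKFbar; letI := T.instIsElliptic
    exact GenuineMOrbit.cor312Of_of_SH T.D (M P l T) (archPk P l T) (archSub P l T) (Ψ P l T) (act P l T) (Mmod P l T)
      (region P l T) (frobAdm P l T) (frobLogvol P l T) (frobΨ P l T) (frobMmod P l T) (unitImage P l T) (ballImage P l T)
      (thetaDiv P l T) (n P l T) (lat P l T) (sig P l T) (split P l T) (qData P l T) (ρ P l T) (qK P l T) T.isVolumeInputOf
      (hSH P l T) (hQPin P l T) (hprov P l T) (hA P l T)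
  -- Step 3: the (U)-line capstone (c312-8 p428563)
  exact ThetaPartII.ABC_of_cor312_of_hullRegime (fun P _ l _ _ _ _ _ _ => h312 P l) hreg

end Family

end Summit.ABC.IUTFork.Conditional
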